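import Summits.QuantumFields.YangMills.Theorems.BalabanUVNodesN15KingModelCycleResolvent
import Mathlib.Analysis.SpecialFunctions.Exp
import HarnessLib

/-!
# BalabanUVNodes ∕ N15 — THE KING-MODEL RUNG (PART Ϲ-a′): READINGS OF THE MASSIVE CYCLE RESOLVENT — IMAGE FORM, POSITIVITY, CLUSTERING ON
# THE PERIODIC AXIS, THE TORUS-vs-INFINITE-AXIS FINITE-SIZE TERM AND THE `n → ∞` LIMIT

HONEST FRAMING.  Count-neutral (cell `pub-ymgap`, seat `pub-ymgap-dag-n15-e` g38; `--supports stmt-QuantumFields-27366 --as helper` = K3⁸).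
TEMPLATE-LITERATURE INFRASTRUCTURE (King 1986 §4 free lattice operators, `A = 0`; the transfer-matrix reading of Montvay–Münster §2.1.2∕§2.2.1,
Drouffe–Zuber (3.43)–(3.46)): consequences of PART Ϲ-a's closed form `g(t) = cosh(ω(val t − n∕2))∕(2 sinh ω sinh(ωn∕2))` of the massive cycle
resolvent.  NOT Bałaban's covariant objects; NOT a node discharge; nothing continuum ∕ ℝ⁴ ∕ OS axioms ∕ Yang–Mills mass gap ∕ Clay.  0 `sorry`.

WHAT THIS FILE PROVES (kernel).  §1 ★★ `eq_mul_cycleGreen_of_recurrence_complex` (UNIQUENESS for complex-valued solutions of the stencil equation —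
the form used by plane-wave channels), `cycleGreen_pos` (STRICT POSITIVITY — Griffiths I for the free chain in closed form).  §2 ★★ **`cycleGreen_eq_exp`**
(THE IMAGE FORM `g(t) = (e^{−ω r} + e^{−ω(n−r)}) ∕ (2 sinh ω (1 − e^{−ωn}))`, `r = val t` — the direct term plus the one image around the period,
normalised by the geometric series of all windings), `cycleGreen_zero_eq`.  §3 ★★ **`exp_le_cycleGreen`** ∕ ★★ **`cycleGreen_sub_exp_le`** (TORUS vs
INFINITE TIME AXIS: `0 ≤ g_n(r) − e^{−ωr}∕(2 sinh ω) ≤ e^{−ω(n−r)}∕(sinh ω (1 − e^{−ωn}))` — the finite-size term is one image, exponentially small in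
the distance `n − r` to the far side of the period), ★ `cycleGreen_le_exp` (CLUSTERING ON THE PERIODIC AXIS `g(t) ≤ g(0)·(e^{−ωr} + e^{−ω(n−r)})`),
★ `cycleGreen_antitoneOn_half` (decreasing in `r` on `0 ≤ r ≤ n∕2`).  §4 ★★ **`tendsto_cycleGreen_atTop`** (THERMODYNAMIC LIMIT OF THE TIME AXIS:
`g_n(r) → e^{−ωr}∕(2 sinh ω)` as `n → ∞` at fixed `r` — the two-point function of the free massive chain on `ℤ`).

Locators: [MontvayMunster1994] §2.1.2 (2.24), (2.49); §2.2.1 (2.72)–(2.78). [DrouffeZuber1983] (3.43)–(3.46) p.41. [King1986] (4.4) p.670.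
-/

noncomputable section

open scoped BigOperators Topology
open Finset Matrix Real Filter

namespace Summit.QuantumFields.YangMills.BalabanUVNodes.N15KingModelRung.TorusSpectral

variable (n : ℕ) [NeZero n]

/-! ## §1 Complex-valued uniqueness; strict positivity -/

section Uniqueness

/-- ★★ UNIQUENESS, complex-valued form (for plane-wave channels): a complex solution of the stencil equation with source `r·[s = 0]`
IS `r·g`. [folklore] -/
theorem eq_mul_cycleGreen_of_recurrence_complex {x : ℝ} (hx : 0 < x) (f : ZMod n → ℂ) (r : ℂ)
    (h : ∀ s, (2 + x) * f s - (f (s + 1) + f (s - 1)) = if s = 0 then r else 0) (t : ZMod n) :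
    f t = r * (cycleGreen n x t : ℂ) := by
  have h' : ∀ s, ((2 + x : ℝ) : ℂ) * f s - (f (s + 1) + f (s - 1)) = if s = 0 then r else 0 := fun s => by
    push_cast; exact h s
  have hre : (fun s => (f s).re) = r.re • cycleGreen n x := by
    refine eq_smul_cycleGreen_of_recurrence n hx _ _ fun s => ?_
    have := congr_arg Complex.re (h' s)
    rw [Complex.sub_re, Complex.add_re, Complex.re_ofReal_mul, apply_ite Complex.re, Complex.zero_re] at this
    exact this
  have him : (fun s => (f s).im) = r.im • cycleGreen n x := by
    refine eq_smul_cycleGreen_of_recurrence n hx _ _ fun s => ?_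
    have := congr_arg Complex.im (h' s)
    rw [Complex.sub_im, Complex.add_im, Complex.im_ofReal_mul, apply_ite Complex.im, Complex.zero_im] at this
    exact this
  apply Complex.ext
  · rw [show (f t).re = (fun s => (f s).re) t from rfl, hre]; simp
  · rw [show (f t).im = (fun s => (f s).im) t from rfl, him]; simp

/-- The cycle Green's function is STRICTLY POSITIVE (`x > 0`) — Griffiths' first inequality for the free chain, in closed form. [folklore] -/
theorem cycleGreen_pos {x : ℝ} (hx : 0 < x) (t : ZMod n) : 0 < cycleGreen n x t := by
  unfold cycleGreen cycleProfile
  exact div_pos (Real.cosh_pos _) (cycleDenom_pos n hx)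


end Uniqueness

/-! ## §2 The image form -/

section ImageForm

omit [NeZero n] in
/-- `cosh(ω(r − n∕2)) = ½e^{ωn∕2}·(e^{−ωr} + e^{−ω(n−r)})`. [folklore] -/
theorem cycleProfile_eq_exp (x r : ℝ) :
    cycleProfile n x r
      = Real.exp (latticeMass x * n / 2) / 2 * (Real.exp (-(latticeMass x * r)) + Real.exp (-(latticeMass x * (n - r)))) := by
  unfold cycleProfile
  rw [Real.cosh_eq, div_mul_eq_mul_div, mul_add, ← Real.exp_add, ← Real.exp_add, add_comm (Real.exp _) (Real.exp _)]
  congr 1; congr 1 <;> congr 1 <;> ring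

omit [NeZero n] in
/-- `sinh(ωn∕2) = ½e^{ωn∕2}·(1 − e^{−ωn})`. [folklore] -/
theorem sinh_half_period_eq_exp (x : ℝ) :
    Real.sinh (latticeMass x * n / 2) = Real.exp (latticeMass x * n / 2) / 2 * (1 - Real.exp (-(latticeMass x * n))) := by
  rw [Real.sinh_eq, div_mul_eq_mul_div, mul_sub, mul_one, ← Real.exp_add]
  congr 1; congr 1; congr 1; ring

/-- `1 − e^{−ωn} > 0` (`x > 0`, `n ≥ 1`). [folklore] -/
theorem one_sub_exp_period_pos {x : ℝ} (hx : 0 < x) : 0 < 1 - Real.exp (-(latticeMass x * n)) := by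
  have hn : (0 : ℝ) < n := by exact_mod_cast Nat.pos_of_ne_zero (NeZero.ne n)
  have : Real.exp (-(latticeMass x * n)) < 1 := Real.exp_lt_one_iff.mpr (by have := latticeMass_pos hx; nlinarith)
  linarith

omit [NeZero n] in
/-- ★★ **THE IMAGE FORM** of the cycle resolvent: `g(t) = (e^{−ωr} + e^{−ω(n−r)}) ∕ (2 sinh ω · (1 − e^{−ωn}))`, `r = val t` — the direct term
`e^{−ωr}∕(2 sinh ω)` (the resolvent of the infinite chain) plus its image `r ↦ n − r` around the period, both normalised by the winding series
`Σ_{w≥0} e^{−ωnw} = (1 − e^{−ωn})⁻¹`. [cite: MontvayMunster1994, §2.1.2 (2.24), (2.49)] -/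
theorem cycleGreen_eq_exp (x : ℝ) (t : ZMod n) :
    cycleGreen n x t
      = (Real.exp (-(latticeMass x * t.val)) + Real.exp (-(latticeMass x * (n - t.val))))
          / (2 * Real.sinh (latticeMass x) * (1 - Real.exp (-(latticeMass x * n)))) := by
  unfold cycleGreen
  rw [cycleProfile_eq_exp, sinh_half_period_eq_exp]
  have hE : Real.exp (latticeMass x * n / 2) / 2 ≠ 0 := by positivity
  rw [mul_comm (Real.exp (latticeMass x * n / 2) / 2) (1 - _), ← mul_assoc, mul_comm (Real.exp (latticeMass x * n / 2) / 2),
    mul_div_mul_right _ _ hE]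

omit [NeZero n] in
/-- The value at the source: `g(0) = (1 + e^{−ωn}) ∕ (2 sinh ω (1 − e^{−ωn})) = coth(ωn∕2)∕(2 sinh ω)`. [folklore] -/
theorem cycleGreen_zero_eq (x : ℝ) :
    cycleGreen n x 0 = (1 + Real.exp (-(latticeMass x * n))) / (2 * Real.sinh (latticeMass x) * (1 - Real.exp (-(latticeMass x * n)))) := by
  rw [cycleGreen_eq_exp, ZMod.val_zero, Nat.cast_zero, mul_zero, neg_zero, Real.exp_zero, sub_zero]

end ImageForm

/-! ## §3 Torus vs infinite axis; clustering on the periodic axis; monotonicity -/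

section Comparison

/-- ★★ **THE TORUS CORRELATOR DOMINATES THE INFINITE-AXIS ONE**: `e^{−ωr}∕(2 sinh ω) ≤ g_n(r)` (`x > 0`; the images are positive).
[cite: MontvayMunster1994, §2.1.2 (2.24)] -/
theorem exp_le_cycleGreen {x : ℝ} (hx : 0 < x) (t : ZMod n) :
    Real.exp (-(latticeMass x * t.val)) / (2 * Real.sinh (latticeMass x)) ≤ cycleGreen n x t := by
  rw [cycleGreen_eq_exp]
  have hs : 0 < Real.sinh (latticeMass x) := Real.sinh_pos_iff.mpr (latticeMass_pos hx)
  have hq := one_sub_exp_period_pos n hx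
  have hq1 : 1 - Real.exp (-(latticeMass x * n)) ≤ 1 := by have := Real.exp_pos (-(latticeMass x * n)); linarith
  rw [div_le_div_iff₀ (by positivity) (by positivity)]
  have h1 : 0 ≤ Real.exp (-(latticeMass x * (n - t.val))) := (Real.exp_pos _).le
  have h2 : 0 < Real.exp (-(latticeMass x * t.val)) := Real.exp_pos _
  nlinarith [mul_nonneg h1 hs.le, mul_le_mul_of_nonneg_left hq1 h2.le]

/-- ★★ **THE FINITE-SIZE TERM IS ONE IMAGE**: `g_n(r) − e^{−ωr}∕(2 sinh ω) ≤ e^{−ω(n−r)} ∕ (sinh ω (1 − e^{−ωn}))` (`x > 0`) — exponentially small in the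
distance `n − r` to the far side of the period, uniformly in `r`. [cite: MontvayMunster1994, §2.1.2 (2.24)] -/
theorem cycleGreen_sub_exp_le {x : ℝ} (hx : 0 < x) (t : ZMod n) :
    cycleGreen n x t - Real.exp (-(latticeMass x * t.val)) / (2 * Real.sinh (latticeMass x))
      ≤ Real.exp (-(latticeMass x * (n - t.val))) / (Real.sinh (latticeMass x) * (1 - Real.exp (-(latticeMass x * n)))) := by
  rw [cycleGreen_eq_exp]
  set ω := latticeMass x
  have hs : 0 < Real.sinh ω := Real.sinh_pos_iff.mpr (latticeMass_pos hx)
  have hq := one_sub_exp_period_pos n hx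
  set q := 1 - Real.exp (-(ω * n)) with hqdef
  set A := Real.exp (-(ω * t.val))
  set B := Real.exp (-(ω * (n - t.val)))
  -- the difference is `(B + A·e^{−ωn}) ∕ (2 sinh ω · q)` and `A·e^{−ωn} = e^{−ω(n+r)} ≤ B`
  have hAe : A * Real.exp (-(ω * n)) ≤ B := by
    rw [← Real.exp_add]
    exact Real.exp_le_exp.mpr (by have := latticeMass_pos hx; have : (0:ℝ) ≤ t.val := Nat.cast_nonneg _; nlinarith)
  have he : Real.exp (-(ω * n)) = 1 - q := by rw [hqdef]; ring
  have hkey : (A + B) / (2 * Real.sinh ω * q) - A / (2 * Real.sinh ω) = (B + A * Real.exp (-(ω * n))) / (2 * Real.sinh ω * q) := by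
    rw [he]
    have hq0 : q ≠ 0 := hq.ne'
    have hs0 : Real.sinh ω ≠ 0 := hs.ne'
    field_simp
    ring
  rw [hkey, div_le_div_iff₀ (by positivity) (by positivity)]
  have hB : 0 ≤ B := (Real.exp_pos _).le
  nlinarith [mul_nonneg hB (mul_pos hs hq).le, mul_le_mul_of_nonneg_right hAe (mul_pos hs hq).le]

/-- ★ **CLUSTERING ON THE PERIODIC AXIS**: `g(t) ≤ g(0)·(e^{−ωr} + e^{−ω(n−r)})` (`x > 0`) — exponential decay at the lattice mass `ω` up to the image
term. [cite: DrouffeZuber1983, (3.43) p.41] -/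
theorem cycleGreen_le_exp {x : ℝ} (hx : 0 < x) (t : ZMod n) :
    cycleGreen n x t ≤ cycleGreen n x 0 * (Real.exp (-(latticeMass x * t.val)) + Real.exp (-(latticeMass x * (n - t.val)))) := by
  rw [cycleGreen_eq_exp, cycleGreen_zero_eq]
  have hs : 0 < Real.sinh (latticeMass x) := Real.sinh_pos_iff.mpr (latticeMass_pos hx)
  have hq := one_sub_exp_period_pos n hx
  rw [div_mul_eq_mul_div, div_le_div_iff₀ (by positivity) (by positivity)]
  have hS : 0 ≤ Real.exp (-(latticeMass x * t.val)) + Real.exp (-(latticeMass x * (n - t.val))) := by positivity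
  have he : 0 ≤ Real.exp (-(latticeMass x * n)) := (Real.exp_pos _).le
  nlinarith [mul_nonneg (mul_nonneg he hS) (mul_pos (mul_pos two_pos hs) hq).le]

/-- ★ **MONOTONICITY ON THE FIRST HALF-PERIOD**: for `val s ≤ val t ≤ n∕2`, `g(t) ≤ g(s)` (`x > 0`; `cosh` is even and increasing in `|·|`).
[folklore] -/
theorem cycleGreen_antitoneOn_half {x : ℝ} (hx : 0 < x) {s t : ZMod n} (hst : s.val ≤ t.val) (ht : 2 * t.val ≤ n) :
    cycleGreen n x t ≤ cycleGreen n x s := by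
  unfold cycleGreen cycleProfile
  have hD := cycleDenom_pos n hx
  rw [div_le_div_iff_of_pos_right hD, Real.cosh_le_cosh]
  have hω := (latticeMass_pos hx).le
  have h1 : latticeMass x * ((t.val : ℝ) - n / 2) ≤ 0 := by
    have : (t.val : ℝ) - n / 2 ≤ 0 := by
      have : (2 * t.val : ℝ) ≤ n := by exact_mod_cast ht
      linarith
    nlinarith
  have h2 : latticeMass x * ((s.val : ℝ) - n / 2) ≤ latticeMass x * ((t.val : ℝ) - n / 2) := by
    have : (s.val : ℝ) ≤ t.val := by exact_mod_cast hst
    nlinarith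
  rw [abs_of_nonpos h1, abs_of_nonpos (h2.trans h1)]
  linarith

end Comparison

/-! ## §4 The thermodynamic limit of the time axis -/

section Limit

/-- ★★ **THERMODYNAMIC LIMIT OF THE PERIODIC AXIS**: at fixed separation `r`, `g_n(r) → e^{−ωr}∕(2 sinh ω)` as the period `n → ∞` (`x > 0`) — the
two-point function of the free massive chain on `ℤ` (the resolvent of `(2+x) − S − S⁻¹` on `ℓ²(ℤ)`). [cite: MontvayMunster1994, §2.1.2 (2.24)] -/
theorem tendsto_cycleGreen_atTop {x : ℝ} (hx : 0 < x) (r : ℕ) :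
    Tendsto (fun k : ℕ => cycleGreen (k + 1) x (r : ZMod (k + 1))) atTop
      (𝓝 (Real.exp (-(latticeMass x * r)) / (2 * Real.sinh (latticeMass x)))) := by
  set ω := latticeMass x
  have hω : 0 < ω := latticeMass_pos hx
  -- eventually `val (r : ZMod (k+1)) = r`
  have hev : ∀ᶠ k : ℕ in atTop, cycleGreen (k + 1) x (r : ZMod (k + 1))
      = (Real.exp (-(ω * r)) + Real.exp (-(ω * (((k + 1 : ℕ) : ℝ) - r)))) / (2 * Real.sinh ω * (1 - Real.exp (-(ω * ((k + 1 : ℕ) : ℝ))))) := by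
    filter_upwards [Filter.eventually_ge_atTop r] with k hk
    rw [cycleGreen_eq_exp, ZMod.val_cast_of_lt (by omega)]
  refine Tendsto.congr' (EventuallyEq.symm hev) ?_
  -- `e^{−ω(k+1−r)} → 0`, `e^{−ω(k+1)} → 0`
  have hlin : Tendsto (fun k : ℕ => ((k + 1 : ℕ) : ℝ)) atTop atTop := by
    exact tendsto_natCast_atTop_atTop.comp (tendsto_add_atTop_nat 1)
  have h1 : Tendsto (fun k : ℕ => Real.exp (-(ω * (((k + 1 : ℕ) : ℝ) - r)))) atTop (𝓝 0) := by
    refine Real.tendsto_exp_atBot.comp ?_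
    refine tendsto_neg_atTop_atBot.comp ?_
    refine Tendsto.const_mul_atTop hω ?_
    exact tendsto_atTop_add_const_right _ _ hlin
  have h2 : Tendsto (fun k : ℕ => Real.exp (-(ω * ((k + 1 : ℕ) : ℝ)))) atTop (𝓝 0) := by
    refine Real.tendsto_exp_atBot.comp ?_
    refine tendsto_neg_atTop_atBot.comp ?_
    exact Tendsto.const_mul_atTop hω hlin
  have hs : (2 * Real.sinh ω * (1 - 0)) ≠ 0 := by
    have := Real.sinh_pos_iff.mpr hω; positivity
  have h3 : Tendsto (fun k : ℕ => Real.exp (-(ω * r)) + Real.exp (-(ω * (((k + 1 : ℕ) : ℝ) - r)))) atTop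
      (𝓝 (Real.exp (-(ω * r)) + 0)) := tendsto_const_nhds.add h1
  have h4 : Tendsto (fun k : ℕ => 2 * Real.sinh ω * (1 - Real.exp (-(ω * ((k + 1 : ℕ) : ℝ))))) atTop
      (𝓝 (2 * Real.sinh ω * (1 - 0))) := tendsto_const_nhds.mul (tendsto_const_nhds.sub h2)
  have h5 := h3.div h4 hs
  rw [add_zero, sub_zero, mul_one] at h5
  exact h5

end Limit

end Summit.QuantumFields.YangMills.BalabanUVNodes.N15KingModelRung.TorusSpectral
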